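import Mathlib
import HarnessLib
import Summits.NavierStokesRegularity.NavierStokesRegularity.Theorems.UnthreadedDoorAntidynamoWallBeltramiAccumulating

/-!
# Route `UnthreadedDoor` / `ThreadingFlux`, crux `PoloidalLiouville` (stmt-NavierStokesRegularity-1222), antidynamo v2 skeleton (sha16 `4ebf5683127b`),
# WALL `stub_scalarLiouville`: generalized Beltrami in a REAL-ANALYTIC MOVING Galilean frame at ACCUMULATING TIMES ⇒ irrotational

Support file (seat leafhand-ns-unthreadeddoor-2 g3, cell decomp-ns), `--supports stmt-NavierStokesRegularity-1222 --as helper`; theorems only.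

`…WallBeltramiAccumulating` (p821303) treats a CONSTANT frame `b`.  The same identity-theorem argument runs for any frame velocity
`b : (−∞,0) → ℝ³` that is REAL-ANALYTIC in time (the Lamb field `(t,y) ↦ (v(t,y) − b(t)) × curl v(t)(y)` is then jointly analytic):

* ★★ `curl_eq_zero_of_lamb_curlFree_analyticFrame_frequently` — class + unthreaded about `x₀` + `b` real-analytic on `(−∞,0)` +
  `curl ((v(t) − b(t)) × curl v(t)) ≡ 0` at times accumulating at some `t₀ < 0` ⇒ `curl v ≡ 0` on `(−∞,0) × ℝ³`
  (so the far-past hypothesis (C5) of the core, for analytic frames, is equivalent to its accumulating-times form (C9));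
* `constant_of_lamb_curlFree_analyticFrame_frequently` — hence slice-wise constant;
* `stubScalarLiouville_of_lamb_curlFree_analyticFrame_frequently` — the wall's letter for this sector.

HONEST LABEL: identity theorem + landed closers; the generic core of the wall (= (ML-a)) is OPEN; nothing here proves `stub_scalarLiouville`,
`PoloidalLiouville` (1222), or bears on Navier–Stokes regularity; no summit statement is proved.
[folklore] [cite: MajdaBertozziCUP2002, §1.1 (vector identities); KochNadirashviliSereginSverak2009, Thm 5.2 (arXiv:0709.3599 pp. 9–10); LemarieRieusset2016, Thm. 9.12]
-/

noncomputable section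

-- the summit and its single sub-problem share the name (CONVENTIONS §1)
set_option linter.dupNamespace false

open scoped Topology InnerProductSpace RealInnerProductSpace ENNReal NNReal
open Filter Set Function Metric MeasureTheory
open Literature.Analysis Literature.Analysis.FluidPDE

namespace Summit.NavierStokesRegularity.NavierStokesRegularity.Theorems.PoloidalLiouville.Antidynamo

open Summit.NavierStokesRegularity.NavierStokesRegularity.Theorems.PoloidalLiouville
  (toroidalPotential exists_norm_curl_le constantOfIrrotational)
open Summit.NavierStokesRegularity.NavierStokesRegularity.Theorems.PoloidalLiouville.NetFlux (E3)

namespace OneInstant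

/-! ### §1 Joint analyticity of the Lamb field in an analytic moving frame -/

/-- **The Lamb field `(t,y) ↦ (V(t,y) − b(t)) × curl V(t)(y)` is jointly analytic** for a jointly analytic `V` and a frame velocity `b`
real-analytic on `(−∞,0)`. [folklore] -/
theorem analyticOnNhd_lamb_frame_uncurry {V : ℝ → E3 → E3} {b : ℝ → E3}
    (hV : AnalyticOnNhd ℝ (uncurry V) (Iio (0 : ℝ) ×ˢ (univ : Set E3))) (hb : AnalyticOnNhd ℝ b (Iio 0)) :
    AnalyticOnNhd ℝ (uncurry fun t y => cross (V t y - b t) (curl (V t) y)) (Iio (0 : ℝ) ×ˢ (univ : Set E3)) := by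
  have hω := CellFlux.analyticOnNhd_curl_uncurry hV
  have hb' : AnalyticOnNhd ℝ (fun p : ℝ × E3 => b p.1) (Iio (0 : ℝ) ×ˢ (univ : Set E3)) :=
    fun p hp => (hb p.1 hp.1).comp analyticAt_fst
  have h1 : AnalyticOnNhd ℝ (fun p : ℝ × E3 => uncurry V p - b p.1) (Iio (0 : ℝ) ×ˢ (univ : Set E3)) := hV.sub hb'
  have hbil := crossCLM.analyticOnNhd_bilinear (univ : Set (E3 × E3))
  have h2 := hbil.comp (h1.prod hω) (mapsTo_univ _ _)
  refine h2.congr (isOpen_Iio.prod isOpen_univ) ?_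
  rintro ⟨t, y⟩ -
  rfl

/-- **Hence `t ↦ curl((V(t) − b(t)) × curl V(t))(x)` is real-analytic on `(−∞,0)` for every `x`.** [folklore] -/
theorem analyticOnNhd_curl_lamb_frame_slice {V : ℝ → E3 → E3} {b : ℝ → E3}
    (hV : AnalyticOnNhd ℝ (uncurry V) (Iio (0 : ℝ) ×ˢ (univ : Set E3))) (hb : AnalyticOnNhd ℝ b (Iio 0)) (x : E3) :
    AnalyticOnNhd ℝ (fun t => curl (fun y => cross (V t y - b t) (curl (V t) y)) x) (Iio 0) := by
  have hL := CellFlux.analyticOnNhd_curl_uncurry (V := fun t y => cross (V t y - b t) (curl (V t) y))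
    (analyticOnNhd_lamb_frame_uncurry hV hb)
  intro t ht
  exact (hL (t, x) ⟨ht, mem_univ _⟩).comp₂ analyticAt_id analyticAt_const

/-! ### ★★ §2 Generalized Beltrami in an analytic moving frame at accumulating times -/

/-- ★★ **GENERALIZED BELTRAMI IN A REAL-ANALYTIC MOVING FRAME AT ACCUMULATING TIMES ⇒ IRROTATIONAL.**  Let `v` be a bounded ancient mild
solution (`ν = 1`, duality class) with measurable slices, jointly smooth on `(−∞,0) × ℝ³`, with vorticity tangent to the spheres about `x₀`, and
let `b : ℝ → ℝ³` be real-analytic on `(−∞,0)`.  If `curl ((v(t) − b(t)) × curl v(t)) ≡ 0` at a set of times accumulating at some `t₀ < 0`, then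
`curl v ≡ 0` on `(−∞,0) × ℝ³`. [cite: KochNadirashviliSereginSverak2009, Thm 5.2 (arXiv:0709.3599 pp. 9–10); LemarieRieusset2016, Thm. 9.12] -/
theorem curl_eq_zero_of_lamb_curlFree_analyticFrame_frequently
    (v : ℝ → EuclideanSpace ℝ (Fin 3) → EuclideanSpace ℝ (Fin 3)) (x₀ : EuclideanSpace ℝ (Fin 3))
    (hB : Literature.Analysis.FluidPDE.IsBoundedAncientMildSolution 1 v)
    (hm : ∀ t < 0, AEStronglyMeasurable (v t) volume)
    (hsm : ContDiffOn ℝ (⊤ : ℕ∞) (Function.uncurry v) (Set.Iio 0 ×ˢ Set.univ))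
    (hun : ∀ t < 0, ∀ x, ⟪x - x₀, curl (v t) x⟫ = 0)
    (b : ℝ → EuclideanSpace ℝ (Fin 3)) (hb : AnalyticOnNhd ℝ b (Iio 0))
    (hfr : ∃ t₀ < 0, ∃ᶠ t in 𝓝[≠] t₀, ∀ x, curl (fun y => cross (v t y - b t) (curl (v t) y)) x = 0) :
    ∀ t < 0, ∀ x, curl (v t) x = 0 := by
  obtain ⟨t₀, ht₀, hfr⟩ := hfr
  obtain ⟨K, hK⟩ := exists_norm_curl_le hB hsm
  obtain ⟨T, -, -, hlink⟩ := toroidalPotential v x₀ K hsm hK hun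
  rcases CellFlux.unthreadedAnalyticOrIrrotational v x₀ T hB hm hsm hlink with hA | hZ
  · -- analytic continuation in time of the curl-free Lamb identity
    have hall : ∀ t < 0, ∀ x, curl (fun y => cross (v t y - b t) (curl (v t) y)) x = 0 := by
      intro t ht x
      have hga := analyticOnNhd_curl_lamb_frame_slice hA hb x
      have hgfr : ∃ᶠ s in 𝓝[≠] t₀, (fun s => curl (fun y => cross (v s y - b s) (curl (v s) y)) x) s = 0 :=
        hfr.mono fun s hs => hs x
      have h0 := hga.eqOn_zero_of_preconnected_of_frequently_eq_zero isPreconnected_Iio ht₀ hgfr ht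
      simpa only [Pi.zero_apply] using h0
    exact curl_eq_zero_of_lamb_curlFree v x₀ hB hm hsm hun b (hb.contDiffOn (uniqueDiffOn_Iio 0)) fun t ht x => hall t ht x
  · exact hZ

/-- ★★ **… HENCE SLICE-WISE CONSTANT.** [cite: KochNadirashviliSereginSverak2009, Thm 5.2 (arXiv:0709.3599 pp. 9–10)] -/
theorem constant_of_lamb_curlFree_analyticFrame_frequently
    (v : ℝ → EuclideanSpace ℝ (Fin 3) → EuclideanSpace ℝ (Fin 3)) (x₀ : EuclideanSpace ℝ (Fin 3))
    (hB : Literature.Analysis.FluidPDE.IsBoundedAncientMildSolution 1 v)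
    (hm : ∀ t < 0, AEStronglyMeasurable (v t) volume)
    (hsm : ContDiffOn ℝ (⊤ : ℕ∞) (Function.uncurry v) (Set.Iio 0 ×ˢ Set.univ))
    (hun : ∀ t < 0, ∀ x, ⟪x - x₀, curl (v t) x⟫ = 0)
    (b : ℝ → EuclideanSpace ℝ (Fin 3)) (hb : AnalyticOnNhd ℝ b (Iio 0))
    (hfr : ∃ t₀ < 0, ∃ᶠ t in 𝓝[≠] t₀, ∀ x, curl (fun y => cross (v t y - b t) (curl (v t) y)) x = 0) :
    ∀ t < 0, ∃ c : EuclideanSpace ℝ (Fin 3), ∀ x, v t x = c :=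
  constantOfIrrotational v hB hsm (curl_eq_zero_of_lamb_curlFree_analyticFrame_frequently v x₀ hB hm hsm hun b hb hfr)

end OneInstant

/-! ### §3 The wall's letter -/

/-- **THE WALL ON ITS «GENERALIZED BELTRAMI IN AN ANALYTIC FRAME AT ACCUMULATING TIMES» SECTOR**: if the wall's conclusion is known for all flows
of its class admitting NO real-analytic frame `b` and `t₀ < 0` with `curl ((v(t) − b(t)) × curl v(t)) ≡ 0` at times accumulating at `t₀`
(hypothesis `hrest`), the wall holds. [cite: KochNadirashviliSereginSverak2009, Thm 5.2 (arXiv:0709.3599 pp. 9–10)] -/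
theorem stubScalarLiouville_of_lamb_curlFree_analyticFrame_frequently
    (hrest : ∀ (v : ℝ → EuclideanSpace ℝ (Fin 3) → EuclideanSpace ℝ (Fin 3)) (x₀ : EuclideanSpace ℝ (Fin 3))
      (T : ℝ → EuclideanSpace ℝ (Fin 3) → ℝ),
      Literature.Analysis.FluidPDE.IsBoundedAncientMildSolution 1 v →
      (∀ t < 0, AEStronglyMeasurable (v t) volume) →
      ContDiffOn ℝ (⊤ : ℕ∞) (Function.uncurry v) (Set.Iio 0 ×ˢ Set.univ) →
      ContDiffOn ℝ (⊤ : ℕ∞) (Function.uncurry T) (Set.Iio 0 ×ˢ ({x₀}ᶜ : Set (EuclideanSpace ℝ (Fin 3)))) →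
      (∃ C : ℝ, ∀ t < 0, ∀ x, |T t x| ≤ C) →
      (∀ t < 0, ∀ x, Literature.Analysis.FluidPDE.curl (v t) x =
        Literature.Analysis.FluidPDE.cross (gradient (T t) x) (x - x₀)) →
      (∀ t < 0, ∀ x, x ≠ x₀ →
        Literature.Analysis.FluidPDE.cross
            (gradient (fun z => deriv (fun s => T s z) t + inner ℝ (v t z) (gradient (T t) z)
              - Laplacian.laplacian (T t) z) x) (x - x₀) =
          Literature.Analysis.FluidPDE.cross (gradient (fun z => inner ℝ (v t z) (z - x₀)) x) (gradient (T t) x)) →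
      (∀ (b : ℝ → EuclideanSpace ℝ (Fin 3)), AnalyticOnNhd ℝ b (Iio 0) → ∀ t₀ : ℝ, t₀ < 0 →
        ¬ ∃ᶠ t in 𝓝[≠] t₀, ∀ x, curl (fun y => cross (v t y - b t) (curl (v t) y)) x = 0) →
      ∀ t < 0, ∀ x, Literature.Analysis.FluidPDE.cross (gradient (T t) x) (x - x₀) = 0) :
    StubScalarLiouville := by
  intro v x₀ T hB hm hsm hT hTb hrep hE
  have hun : ∀ t < 0, ∀ x, ⟪x - x₀, curl (v t) x⟫ = 0 := fun t ht x => by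
    rw [hrep t ht x]
    simp [cross, crossProduct, PiLp.inner_apply, Fin.sum_univ_three]
    ring
  by_cases h0 : ∀ t < 0, ∀ x, curl (v t) x = 0
  · intro t ht x
    rw [← hrep t ht x]
    exact h0 t ht x
  have hC : ∀ (b : ℝ → EuclideanSpace ℝ (Fin 3)), AnalyticOnNhd ℝ b (Iio 0) → ∀ t₀ : ℝ, t₀ < 0 →
      ¬ ∃ᶠ t in 𝓝[≠] t₀, ∀ x, curl (fun y => cross (v t y - b t) (curl (v t) y)) x = 0 :=
    fun b hb t₀ ht₀ hfr =>
      h0 (OneInstant.curl_eq_zero_of_lamb_curlFree_analyticFrame_frequently v x₀ hB hm hsm hun b hb ⟨t₀, ht₀, hfr⟩)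
  exact hrest v x₀ T hB hm hsm hT hTb hrep hE hC

end Summit.NavierStokesRegularity.NavierStokesRegularity.Theorems.PoloidalLiouville.Antidynamo

end
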